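import Summits.BirchSwinnertonDyer.Rank1Residual.X11a.OrdinaryLineCohomology
import Literature.NumberTheory.EllipticCurves.OrdinaryLocalReductionMapProofs
import HarnessLib

/-!
# Route (3e) SELMER COMPANION, VII: at a good ordinary `v ∣ p`, every cocycle with values in the
# (twisted) kernel-of-reduction line is a Kummer class (class X11a = N7; cell `b2b-bsdres`, unit
# `b2b-bsdres-x11a`, gen 27)

HONEST FRAMING (run/shared/lean/b2b/bsd-rank1-residual/, verbatim in every file): the goal of the
cell is to DELETE the COMBINATION-SHAPED residual classes of the Birch–Swinnerton-Dyer formula for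
ALL analytic-rank `≤ 1` elliptic curves over `ℚ` — "full BSD formula for every rank `≤ 1` curve in
class `C`" assembled STRICTLY from published theorems — so that the rank-`≤ 1` remainder becomes
exactly the CONSTRUCTION-SHAPED classes, which are TYPED (missing-input `Prop`s), NOT attempted.
This is not "finishing BSD". CLASS-OWNERS.md: research routes; NO CLAIM BEYOND STATED CLASSES.
THEOREMS ONLY; nothing booked; no label moves. CONDITIONAL on the PUBLISHED named fact
`localEulerPoincareCharacteristic ℚ_v` (Milne *ADT* I Thm. 2.8) where it is a hypothesis.

## What (lemma L-p-ns of the gen-26 census, step 2 of 3)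

`A = W/ℚ` globally minimal with GOOD ORDINARY reduction at the odd prime `p` (`p ∤ Δ_A`, `p ∤ a_p`),
`v ∋ p`, `F = ℚ_v`, `Γ = Γ_F`, `w` the spectral valuation of `F̄`, `A₁ = E₁(F̄) ≤ A(F̄)` the
kernel of reduction (the tree's `FormalGroupChart.kernel w`, `= ker red₀` for the reduction map of
`OrdinaryLocalReductionMapProofs`) and `C = A₁ ∩ A[p]` — a `Γ`-stable line of order `p`
(`localRed_ordinary_filtration`). Two theorems:

* `smul_sub_mem_kernel_of_mem_inertia` — **local inertia acts trivially on the reduction**: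
  `ι Q - Q ∈ A₁` for `ι ∈ I_𝔐 ≤ Γ_F` and every `Q ∈ A(F̄)` (`ι` moves `w`-integral coordinates by
  elements of `𝔪`; `reducePoint_congrEquiv_smul_eq_of_val`).
* `exists_eq_coboundary_of_kernelValued` — **if `C` is twisted as in file VI** ((α): some `ι`
  acts by `2` on a non-zero element; (β): some `σ₀` acts by `a` on `μ_p` and by `-a` on a non-zero
  element) **then every continuous crossed homomorphism `f : Γ_F → A(F̄)` with values in `C` is a
  coboundary: `f σ = σ b - b` for some `b ∈ A(F̄)`.** PROOF (Kummer theory on the formal group,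
  counted): `#H¹(Γ_F, C) = p` (file VI); the rational point `u ∈ A₁(F)` with local parameter
  `z(u) = p` (`exists_mem_kernel_zCoord_eq`) and its multiples `i u`, `0 ≤ i < p`, have `p`-th
  "roots" `Q_i ∈ A₁` (`A₁` is `p`-divisible, `localRed_ordinary_filtration`), whose coboundaries
  `∂Q_i` are `C`-valued continuous cocycles with PAIRWISE DISTINCT classes — if `∂Q_j - ∂Q_i = ∂T`,
  `T ∈ C`, then `R = Q_j - Q_i - T ∈ A₁(F)` has `p R = (j-i) u`, but `|z(R)| ≤ |p|`
  (`val_zCoord_le_of_forall_smul_eq`) forces `|z(pR)| ≤ |p|²` (`val_zCoord_nsmul`) while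
  `|z((j-i)u)| = |p|` (`val_zCoord_nsmul_eq_of_lt`); so the `p` Kummer classes exhaust
  `H¹(Γ_F, C)`, and `[f] = [∂Q_i]` gives `f = ∂(Q_i + T)`.

(Greenberg's "image of the local Kummer map at an ordinary prime = image of `H¹` of the canonical
subgroup", LNM 1716 §2 Props. 2.2, 2.4, mod `p` at a NON-ANOMALOUS prime; (α), (β) are what a
NON-SPLIT multiplicative congruent partner imposes on `C`, file VIII.) References: [GreenbergLNM1716]
§2 Props. 2.2, 2.4; [SilvermanAEC2009] IV.3.2, VII.2.1–2.2; [MilneADT2006] I Thm. 2.8; REPORT-g27.md.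
-/

set_option autoImplicit false

noncomputable section

open scoped Classical NNReal

open WeierstrassCurve Literature.NumberTheory.EllipticCurves
  Literature.NumberTheory.GaloisRepresentations Field NumberField IsDedekindDomain
  IsDedekindDomain.HeightOneSpectrum Literature.NumberTheory.EllipticCurves.FormalGroupChart

namespace Summit.BirchSwinnertonDyer.Rank1Residual.X11a.OrdinaryLine

variable {v : HeightOneSpectrum (𝓞 ℚ)} {p : ℕ} [hp : Fact p.Prime]
  {w : Valuation (AlgebraicClosure (v.adicCompletion ℚ)) ℝ≥0}
  (hw : ∀ x, (w x : ℝ) =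
    spectralNorm (v.adicCompletion ℚ) (AlgebraicClosure (v.adicCompletion ℚ)) x)
  (A : WeierstrassCurve ℚ) [A.IsGloballyMinimal]

include hw in
/-- **Local inertia acts trivially on the reduction**: for `A/ℚ` globally minimal with good
reduction at `p` (`p ∤ Δ_A`), `v ∋ p`, a prime `𝔐` of `\bar 𝓞_v` and `ι` in its inertia group,
`ι Q - Q` lies in the kernel of reduction `A₁(K̄_v)` for every `Q ∈ A(K̄_v)` (the `w`-integral
coordinates of `Q` are moved by `ι` within `𝔪_w`, so `ιQ` and `Q` have the same reduction).
Silverman, *AEC*, VII.§2, VIII.§1. [cite: SilvermanAEC2009, Prop. VII.2.1] -/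
theorem smul_sub_mem_kernel_of_mem_inertia (hpv : (p : 𝓞 ℚ) ∈ v.asIdeal)
    (hΔ : ¬ (p : ℤ) ∣ minimalDiscriminantInt A)
    [hV : (A.baseChange (AlgebraicClosure (v.adicCompletion ℚ))).IsIntegral w.integer]
    {𝔐 : Ideal v.localAbsIntegers} (h𝔐 : 𝔐 ∈ v.localPrimesAbove)
    {ι : absoluteGaloisGroup (v.adicCompletion ℚ)}
    (hι : ι ∈ 𝔐.inertia (absoluteGaloisGroup (v.adicCompletion ℚ)))
    (Q : localPoints A (v.adicCompletion ℚ)) :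
    ((ι • Q - Q : localPoints A (v.adicCompletion ℚ)) :
      (A.baseChange (AlgebraicClosure (v.adicCompletion ℚ))).toAffine.Point) ∈
      kernel w (A.baseChange (AlgebraicClosure (v.adicCompletion ℚ))) := by
  have hvO : w.Integers w.valuationSubring := Valuation.valuationSubring.integers w
  have hΔu := A.isUnit_Δ_localIntModel hpv hw hΔ
  let red₀ : localPoints A (v.adicCompletion ℚ) →+
      (((integralModelInt A).map (algebraMap ℤ ↥w.valuationSubring)).map
        (IsLocalRing.residue ↥w.valuationSubring)).toAffine.Point :=
    (goodReductionHom _ hvO hΔu).comp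
      (Affine.Point.congrEquiv (localIntModel_baseChange A w.valuationSubring).symm).toAddMonoidHom
  have hred₀ : ∀ P : localPoints A (v.adicCompletion ℚ), red₀ P =
      ((integralModelInt A).map (algebraMap ℤ ↥w.valuationSubring)).reducePoint
        (Affine.Point.congrEquiv (localIntModel_baseChange A w.valuationSubring).symm P) :=
    fun P ↦ rfl
  have h1 : red₀ (ι • Q) = red₀ Q := by
    rw [hred₀, hred₀]
    exact reducePoint_congrEquiv_smul_eq_of_val hw (localIntModel_baseChange A w.valuationSubring)
      ι Q (fun x y _ _ ↦ ⟨fun hx ↦ (mem_inertia_iff_spectralValuation hw h𝔐).1 hι x hx,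
        fun hy ↦ (mem_inertia_iff_spectralValuation hw h𝔐).1 hι y hy⟩)
  have h2 : red₀ (ι • Q - Q) = 0 := by rw [map_sub, h1, sub_self]
  rw [← A.localRed_eq_zero_iff_mem_kernel hΔu red₀ hred₀ (ι • Q - Q)]
  exact h2

set_option maxHeartbeats 400000 in
include hw in
/-- **At a good ordinary `v ∣ p`, every continuous crossed homomorphism `Γ_{ℚ_v} → A(K̄_v)` with
values in the twisted kernel-of-reduction line `C = A₁ ∩ A[p]` is a coboundary** (see the module
docstring: `#H¹(Γ, C) = p` by file VI, and the `p` Kummer classes of the multiples of the point of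
`A₁(ℚ_v)` with local parameter `p` are pairwise distinct by the level calculus of the formal group,
hence exhaust `H¹(Γ, C)`). Hypotheses: `p` odd; `p ∤ Δ_A`, `p ∤ a_p(A)`; the twist (α) `ι T₁ = 2T₁`
and (β) `σ₀ ζ = ζ^a` on `μ_p`, `σ₀ T₁ = -a T₁` for non-zero `T₁ ∈ C`; Tate's local Euler
characteristic (`hEP`, named fact). [cite: GreenbergLNM1716, §2 Props. 2.2, 2.4]
[cite: SilvermanAEC2009, Prop. IV.3.2 and Prop. VII.2.2] [cite: MilneADT2006, Ch. I §2, Thm. 2.8] -/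
theorem exists_eq_coboundary_of_kernelValued
    (hEP : localEulerPoincareCharacteristic (v.adicCompletion ℚ)) (hp2 : p ≠ 2)
    (hpv : (p : 𝓞 ℚ) ∈ v.asIdeal) [A.IsElliptic]
    (hΔ : ¬ (p : ℤ) ∣ minimalDiscriminantInt A) (hord : ¬ (p : ℤ) ∣ A.frobeniusTrace p)
    [hV : (A.baseChange (AlgebraicClosure (v.adicCompletion ℚ))).IsIntegral w.integer]
    (hα : ∃ (ι : absoluteGaloisGroup (v.adicCompletion ℚ)) (T₁ : localPoints A (v.adicCompletion ℚ)),
      (p : ℤ) • T₁ = 0 ∧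
      (T₁ : (A.baseChange (AlgebraicClosure (v.adicCompletion ℚ))).toAffine.Point) ∈
        kernel w (A.baseChange (AlgebraicClosure (v.adicCompletion ℚ))) ∧
      T₁ ≠ 0 ∧ ι • T₁ = (2 : ℤ) • T₁)
    (hβ : ∃ (σ₀ : absoluteGaloisGroup (v.adicCompletion ℚ)) (a : ℕ)
      (T₁ : localPoints A (v.adicCompletion ℚ)),
      (∀ ζ : AlgebraicClosure (v.adicCompletion ℚ), ζ ^ p = 1 → σ₀ • ζ = ζ ^ a) ∧
      (p : ℤ) • T₁ = 0 ∧
      (T₁ : (A.baseChange (AlgebraicClosure (v.adicCompletion ℚ))).toAffine.Point) ∈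
        kernel w (A.baseChange (AlgebraicClosure (v.adicCompletion ℚ))) ∧
      T₁ ≠ 0 ∧ σ₀ • T₁ = -((a : ℤ) • T₁))
    (f : absoluteGaloisGroup (v.adicCompletion ℚ) → localPoints A (v.adicCompletion ℚ))
    (hfc : Continuous f) (hf1 : ∀ σ τ, f (σ * τ) = f σ + σ • f τ)
    (hfp : ∀ σ, (p : ℤ) • f σ = 0)
    (hfk : ∀ σ, (f σ : (A.baseChange (AlgebraicClosure (v.adicCompletion ℚ))).toAffine.Point) ∈
      kernel w (A.baseChange (AlgebraicClosure (v.adicCompletion ℚ)))) :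
    ∃ b : localPoints A (v.adicCompletion ℚ), ∀ σ, f σ = σ • b - b := by
  have hpp : p.Prime := hp.out
  haveI : NeZero p := ⟨hpp.ne_zero⟩
  -- NB: no `CharZero` instances here (they would re-route `Algebra ℚ _` instances over `ℚ`).
  obtain ⟨hp1, hp0⟩ := spectralValuation_natCast_prime_lt_one_and_pos (p := p) hw hpv
  obtain ⟨𝔐, h𝔐⟩ := v.localPrimesAbove_nonempty
  have hϖ : Irreducible ((p : ℕ) : v.adicCompletionIntegers ℚ) :=
    irreducible_natCast_adicCompletionIntegers_rat hpv
  -- the reduction map of the local integral model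
  have hvO : w.Integers w.valuationSubring := Valuation.valuationSubring.integers w
  have hΔu := A.isUnit_Δ_localIntModel hpv hw hΔ
  let red₀ : localPoints A (v.adicCompletion ℚ) →+
      (((integralModelInt A).map (algebraMap ℤ ↥w.valuationSubring)).map
        (IsLocalRing.residue ↥w.valuationSubring)).toAffine.Point :=
    (goodReductionHom _ hvO hΔu).comp
      (Affine.Point.congrEquiv (localIntModel_baseChange A w.valuationSubring).symm).toAddMonoidHom
  have hred₀ : ∀ P : localPoints A (v.adicCompletion ℚ), red₀ P =
      ((integralModelInt A).map (algebraMap ℤ ↥w.valuationSubring)).reducePoint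
        (Affine.Point.congrEquiv (localIntModel_baseChange A w.valuationSubring).symm P) :=
    fun P ↦ rfl
  haveI hchar : CharP (IsLocalRing.ResidueField ↥w.valuationSubring) p := by
    refine (CharP.charP_iff_prime_eq_zero hpp).mpr ?_
    rw [← map_natCast (IsLocalRing.residue ↥w.valuationSubring), IsLocalRing.residue_eq_zero_iff,
      IsLocalRing.mem_maximalIdeal, mem_nonunits_iff, hvO.isUnit_iff_valuation_eq_one]
    exact fun h ↦ absurd h (ne_of_lt (by simpa using hp1))
  have hker : ∀ P : localPoints A (v.adicCompletion ℚ), red₀ P = 0 ↔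
      (P : (A.baseChange (AlgebraicClosure (v.adicCompletion ℚ))).toAffine.Point) ∈ kernel w (A.baseChange (AlgebraicClosure (v.adicCompletion ℚ))) :=
    fun P ↦ A.localRed_eq_zero_iff_mem_kernel hΔu red₀ hred₀ P
  have hstab : ∀ (σ : absoluteGaloisGroup (v.adicCompletion ℚ))
      (Q : localPoints A (v.adicCompletion ℚ)), red₀ Q = 0 → red₀ (σ • Q) = 0 :=
    fun σ Q hQ ↦ (A.localRed_smul_eq_zero_iff hw hΔu red₀ hred₀ σ Q).mpr hQ
  obtain ⟨hgenr, -, hdiv₁⟩ := A.localRed_ordinary_filtration hΔu red₀ hred₀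
    (A.exists_zsmul_eq_zero_localRed_ne_zero hw hΔu red₀ hred₀ hpv hΔ hord)
  -- the line `C = A₁ ∩ A[p]`
  let C : Submodule ℤ (localPoints A (v.adicCompletion ℚ)) :=
    { carrier := {T | red₀ T = 0 ∧ (p : ℤ) • T = 0}
      add_mem' := fun {a b} ha hb ↦ ⟨by rw [map_add, ha.1, hb.1, add_zero],
        by rw [smul_add, ha.2, hb.2, add_zero]⟩
      zero_mem' := ⟨map_zero red₀, smul_zero _⟩
      smul_mem' := fun k T hT ↦ ⟨by rw [map_zsmul, hT.1]; exact zsmul_zero _,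
        by rw [smul_comm, hT.2]; exact zsmul_zero _⟩ }
  have hmemC : ∀ T, T ∈ C ↔ red₀ T = 0 ∧ (p : ℤ) • T = 0 := fun T ↦ Iff.rfl
  have hCstab : ∀ σ : absoluteGaloisGroup (v.adicCompletion ℚ),
      C ≤ C.comap ((A.localGaloisModule (v.adicCompletion ℚ)) σ) := by
    intro σ T hT
    rw [Submodule.mem_comap]
    change σ • T ∈ C
    exact ⟨hstab σ T hT.1, by rw [← smul_zsmul_localPoints, hT.2, smul_zero]⟩
  -- `C` is cyclic of order `p`
  obtain ⟨P₁, hP₁0, hordP₁, hgenP₁⟩ := hgenr 1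
  rw [pow_one] at hordP₁
  have hCeq : C.toAddSubgroup = AddSubgroup.zmultiples P₁ := by
    apply le_antisymm
    · intro T hT
      obtain ⟨c, rfl⟩ := hgenP₁ T hT.1 (by rw [pow_one]; exact hT.2)
      exact AddSubgroup.mem_zmultiples_iff.mpr ⟨c, natCast_zsmul _ _⟩
    · refine AddSubgroup.zmultiples_le_of_mem ⟨hP₁0, ?_⟩
      rw [natCast_zsmul, ← hordP₁]
      exact addOrderOf_nsmul_eq_zero P₁
  have hcardC : Nat.card C = p := by
    change Nat.card C.toAddSubgroup = p
    rw [hCeq, Nat.card_zmultiples, hordP₁]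
  haveI hfinC : Finite C := Nat.finite_of_card_ne_zero (by rw [hcardC]; exact hpp.ne_zero)
  -- `#H¹(Γ, C) = p` (file VI)
  obtain ⟨hfinH, hcardH⟩ := natCard_H1_eq_of_line hEP hp2 hpv A C hCstab hcardC
    (by
      obtain ⟨ι, T₁, hpT₁, hkT₁, hT₁0, hι⟩ := hα
      exact ⟨ι, T₁, (hmemC T₁).mpr ⟨(hker T₁).mpr hkT₁, hpT₁⟩, hT₁0, hι⟩)
    (by
      obtain ⟨σ₀, a, T₁, hμ, hpT₁, hkT₁, hT₁0, hσ₀⟩ := hβ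
      exact ⟨σ₀, a, T₁, hμ, (hmemC T₁).mpr ⟨(hker T₁).mpr hkT₁, hpT₁⟩, hT₁0, hσ₀⟩)
  set X := (ContinuousRep.subrepresentation (A.localGaloisModule (v.adicCompletion ℚ)) C
    hCstab).toTopRep with hX
  -- continuous crossed homomorphisms with values in `C` as cocycles of `X`
  have mkCocycle : ∀ g : absoluteGaloisGroup (v.adicCompletion ℚ) →
      localPoints A (v.adicCompletion ℚ), Continuous g → (∀ σ τ, g (σ * τ) = g σ + σ • g τ) →
      (∀ σ, g σ ∈ C) → ∃ φ : contOneCocycles X,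
        ∀ σ, ((φ.1 σ : C) : localPoints A (v.adicCompletion ℚ)) = g σ := by
    intro g hgc hg1 hgC
    refine ⟨⟨⟨fun σ ↦ ⟨g σ, hgC σ⟩, hgc.subtype_mk _⟩, fun σ τ ↦ ?_⟩, fun σ ↦ rfl⟩
    apply Subtype.ext
    exact hg1 σ τ
  -- unfolding the action of `X` on `C`
  have hXρ : ∀ (σ : absoluteGaloisGroup (v.adicCompletion ℚ)) (c : C),
      ((X.ρ σ c : C) : localPoints A (v.adicCompletion ℚ)) =
        σ • (c : localPoints A (v.adicCompletion ℚ)) := fun σ c ↦ rfl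
  -- the rational point `u ∈ A₁(ℚ_v)` with local parameter `z(u) = p`
  have hbb : (A.baseChange (v.adicCompletion ℚ)).baseChange (AlgebraicClosure (v.adicCompletion ℚ)) = A.baseChange (AlgebraicClosure (v.adicCompletion ℚ)) :=
    (A.map_baseChange (IsScalarTower.toAlgHom ℚ (v.adicCompletion ℚ) (AlgebraicClosure (v.adicCompletion ℚ))) : _)
  haveI hV' : ((A.baseChange (v.adicCompletion ℚ)).baseChange (AlgebraicClosure (v.adicCompletion ℚ))).IsIntegral w.integer := by
    rw [hbb]; exact hV
  set T : ((A.baseChange (v.adicCompletion ℚ)).baseChange (AlgebraicClosure (v.adicCompletion ℚ))).toAffine.Point ≃+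
      localPoints A (v.adicCompletion ℚ) := Affine.Point.congrEquiv hbb with hTdef
  obtain ⟨P, hPker, hPz, hPfix⟩ :=
    exists_mem_kernel_zCoord_eq (w := w) (A.baseChange (v.adicCompletion ℚ)) hp1
  have hTsome : ∀ x y h, ∃ h', T (.some x y h) = .some x y h' := fun x y h ↦
    ⟨_, Affine.Point.congrEquiv_some hbb h⟩
  have hTz : ∀ Q : ((A.baseChange (v.adicCompletion ℚ)).baseChange (AlgebraicClosure (v.adicCompletion ℚ))).toAffine.Point,
      ((T Q : localPoints A (v.adicCompletion ℚ)) : (A.baseChange (AlgebraicClosure (v.adicCompletion ℚ))).toAffine.Point).zCoord =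
        Q.zCoord := by
    intro Q
    rcases Q with _ | ⟨x, y, h⟩
    · rw [← WeierstrassCurve.Affine.Point.zero_def, map_zero]; rfl
    · obtain ⟨h', e⟩ := hTsome x y h
      rw [e]; rfl
  have hTker : ∀ Q : ((A.baseChange (v.adicCompletion ℚ)).baseChange (AlgebraicClosure (v.adicCompletion ℚ))).toAffine.Point,
      Q ∈ kernel w ((A.baseChange (v.adicCompletion ℚ)).baseChange (AlgebraicClosure (v.adicCompletion ℚ))) →
      ((T Q : localPoints A (v.adicCompletion ℚ)) : (A.baseChange (AlgebraicClosure (v.adicCompletion ℚ))).toAffine.Point) ∈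
        kernel w (A.baseChange (AlgebraicClosure (v.adicCompletion ℚ))) := by
    intro Q hQ
    rcases Q with _ | ⟨x, y, h⟩
    · rw [← WeierstrassCurve.Affine.Point.zero_def, map_zero]; exact (kernel w _).zero_mem
    · obtain ⟨h', e⟩ := hTsome x y h
      rw [e]
      exact some_mem_kernel (w := w) h' ((some_mem_kernel_iff (w := w) h).mp hQ)
  have hTsmul : ∀ (σ : absoluteGaloisGroup (v.adicCompletion ℚ))
      (Q : ((A.baseChange (v.adicCompletion ℚ)).baseChange (AlgebraicClosure (v.adicCompletion ℚ))).toAffine.Point),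
      σ • (T Q : localPoints A (v.adicCompletion ℚ)) =
        T (Affine.Point.map (show (AlgebraicClosure (v.adicCompletion ℚ)) ≃ₐ[v.adicCompletion ℚ] (AlgebraicClosure (v.adicCompletion ℚ)) from σ :
          (AlgebraicClosure (v.adicCompletion ℚ)) →ₐ[v.adicCompletion ℚ] (AlgebraicClosure (v.adicCompletion ℚ))) Q) := by
    intro σ Q
    rcases Q with _ | ⟨x, y, h⟩
    · rw [← WeierstrassCurve.Affine.Point.zero_def, Affine.Point.map_zero, map_zero]
      exact smul_zero σ
    · obtain ⟨h', e⟩ := hTsome x y h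
      rw [e, Affine.Point.map_some, localPoints.smul_def, Affine.Point.map_some]
      obtain ⟨h'', e'⟩ := hTsome _ _ ((WeierstrassCurve.Affine.baseChange_nonsingular
        (W := (A.baseChange (v.adicCompletion ℚ)).toAffine)
        (show (AlgebraicClosure (v.adicCompletion ℚ)) ≃ₐ[v.adicCompletion ℚ] (AlgebraicClosure (v.adicCompletion ℚ)) from σ : (AlgebraicClosure (v.adicCompletion ℚ)) →ₐ[v.adicCompletion ℚ] (AlgebraicClosure (v.adicCompletion ℚ))).injective ..).mpr h)
      rw [e']
      rfl
  set u : localPoints A (v.adicCompletion ℚ) := T P with hudef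
  have hufix : ∀ σ : absoluteGaloisGroup (v.adicCompletion ℚ), σ • u = u := fun σ ↦ by
    rw [hudef, hTsmul, hPfix σ (fun z ↦ spectralValuation_smul hw σ z) (by rw [map_natCast])]
  have huker : (u : (A.baseChange (AlgebraicClosure (v.adicCompletion ℚ))).toAffine.Point) ∈ kernel w (A.baseChange (AlgebraicClosure (v.adicCompletion ℚ))) := hTker P hPker
  have huz : w (u : (A.baseChange (AlgebraicClosure (v.adicCompletion ℚ))).toAffine.Point).zCoord = w (p : (AlgebraicClosure (v.adicCompletion ℚ))) := by
    rw [hudef, hTz, hPz]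
  have hured : red₀ u = 0 := (hker u).mpr huker
  -- `p`-th roots `Q i` of the multiples `i • u` inside `A₁`
  choose Q hQ using fun i : ℕ ↦ hdiv₁ (i • u) (by rw [map_nsmul, hured]; exact nsmul_zero _)
  -- their coboundaries are `C`-valued continuous cocycles
  have hdC : ∀ (i : ℕ) (σ : absoluteGaloisGroup (v.adicCompletion ℚ)), σ • Q i - Q i ∈ C := by
    intro i σ
    refine ⟨by rw [map_sub, hstab σ _ (hQ i).1, (hQ i).1, sub_zero], ?_⟩
    rw [smul_sub, ← smul_zsmul_localPoints, natCast_zsmul, (hQ i).2, sub_eq_zero,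
      ← natCast_zsmul, smul_zsmul_localPoints, hufix]
  choose φ hφ using fun i : ℕ ↦ mkCocycle (fun σ ↦ σ • Q i - Q i)
    ((continuous_smul_localPoints A (v.adicCompletion ℚ) (Q i)).sub continuous_const)
    (fun σ τ ↦ by rw [mul_smul, smul_sub]; abel) (hdC i)
  -- two cocycles of `X` with the same class differ by a principal one
  have hsub_class : ∀ ψ₁ ψ₂ : contOneCocycles X,
      oneCocycleClass X ψ₁ = oneCocycleClass X ψ₂ →
        ∃ c : C, ∀ σ, ((ψ₁.1 σ : C) : localPoints A (v.adicCompletion ℚ)) -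
          ((ψ₂.1 σ : C) : localPoints A (v.adicCompletion ℚ)) =
          σ • (c : localPoints A (v.adicCompletion ℚ)) - (c : localPoints A (v.adicCompletion ℚ)) := by
    intro ψ₁ ψ₂ h
    have h0 : oneCocycleClass X (ψ₁ - ψ₂) = 0 := by
      have := map_sub (oneCocycleClassₗ X) ψ₁ ψ₂
      rw [oneCocycleClassₗ_apply, oneCocycleClassₗ_apply, oneCocycleClassₗ_apply, h, sub_self]
        at this
      exact this
    obtain ⟨c, hc⟩ := (oneCocycleClass_eq_zero_iff X _).mp h0
    refine ⟨c, fun σ ↦ ?_⟩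
    have h1 := congrArg (fun x : C ↦ (x : localPoints A (v.adicCompletion ℚ))) (hc σ)
    exact h1
  -- the Kummer classes `[∂Q_i]`, `i < p`, are pairwise distinct (level calculus on `A₁`)
  have hkey : ∀ i j : ℕ, j < p → i < j →
      oneCocycleClass X (φ j) = oneCocycleClass X (φ i) → False := by
    intro i j hj hij heq
    obtain ⟨c, hc⟩ := hsub_class (φ j) (φ i) heq
    set R : localPoints A (v.adicCompletion ℚ) :=
      Q j - Q i - (c : localPoints A (v.adicCompletion ℚ)) with hRdef
    have hRfix : ∀ σ : absoluteGaloisGroup (v.adicCompletion ℚ), σ • R = R := by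
      intro σ
      have h1 := hc σ
      rw [hφ j σ, hφ i σ] at h1
      rw [hRdef, smul_sub, smul_sub]
      have h2 : σ • Q j - σ • Q i - σ • (c : localPoints A (v.adicCompletion ℚ)) -
          (Q j - Q i - (c : localPoints A (v.adicCompletion ℚ))) = 0 := by
        rw [show σ • Q j - σ • Q i - σ • (c : localPoints A (v.adicCompletion ℚ)) -
          (Q j - Q i - (c : localPoints A (v.adicCompletion ℚ))) =
          (σ • Q j - Q j) - (σ • Q i - Q i) -
            (σ • (c : localPoints A (v.adicCompletion ℚ)) - (c : localPoints A (v.adicCompletion ℚ)))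
          by abel, h1, sub_self]
      exact sub_eq_zero.mp h2
    have hRred : red₀ R = 0 := by
      rw [hRdef, map_sub, map_sub, (hQ j).1, (hQ i).1, c.2.1, sub_zero, sub_zero]
    have hRker : (R : (A.baseChange (AlgebraicClosure (v.adicCompletion ℚ))).toAffine.Point) ∈ kernel w (A.baseChange (AlgebraicClosure (v.adicCompletion ℚ))) :=
      (hker R).mp hRred
    obtain ⟨d, hd⟩ : ∃ d : ℕ, j = i + d := ⟨j - i, by omega⟩
    have hd0 : 0 < d := by omega
    have hdp : ¬ p ∣ d := fun h ↦ by
      have : p ≤ d := Nat.le_of_dvd hd0 h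
      omega
    have hpR : p • R = d • u := by
      rw [hRdef, smul_sub, smul_sub, (hQ j).2, (hQ i).2, hd, add_nsmul, ← natCast_zsmul c.1 p,
        c.2.2, sub_zero, add_sub_cancel_left]
    -- pass to the point type of `A ⊗ K̄_v` for the formal-group estimates
    obtain ⟨uP, huP⟩ : ∃ uP : (A.baseChange (AlgebraicClosure (v.adicCompletion ℚ))).toAffine.Point,
        uP = u := ⟨u, rfl⟩
    obtain ⟨RP, hRP⟩ : ∃ RP : (A.baseChange (AlgebraicClosure (v.adicCompletion ℚ))).toAffine.Point,
        RP = R := ⟨R, rfl⟩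
    have huPker : uP ∈ kernel w (A.baseChange (AlgebraicClosure (v.adicCompletion ℚ))) := by
      rw [huP]; exact huker
    have huPz : w uP.zCoord = w (p : (AlgebraicClosure (v.adicCompletion ℚ))) := by
      rw [huP]; exact huz
    have hRPker : RP ∈ kernel w (A.baseChange (AlgebraicClosure (v.adicCompletion ℚ))) := by
      rw [hRP]; exact hRker
    have hpRP : p • RP = d • uP := by rw [hRP, huP]; exact hpR
    -- `|z(R)| ≤ |p|`, so `|z(pR)| ≤ |p|²`
    have hzR : w RP.zCoord ≤ w (p : (AlgebraicClosure (v.adicCompletion ℚ))) := by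
      rw [hRP]; exact val_zCoord_le_of_forall_smul_eq (p := p) hw h𝔐 hϖ hRker hRfix
    obtain ⟨-, -, hest⟩ := val_zCoord_nsmul (w := w)
      (V := A.baseChange (AlgebraicClosure (v.adicCompletion ℚ))) p hRPker
    have hzpR : w (p • RP).zCoord ≤ w (p : (AlgebraicClosure (v.adicCompletion ℚ))) ^ 2 := by
      have e : (p • RP).zCoord = ((p • RP).zCoord -
          (p : (AlgebraicClosure (v.adicCompletion ℚ))) * RP.zCoord) +
          (p : (AlgebraicClosure (v.adicCompletion ℚ))) * RP.zCoord := by ring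
      rw [e]
      refine (Valuation.map_add w _ _).trans (max_le (hest.trans ?_) ?_)
      · rw [sq, sq]; exact mul_le_mul' hzR hzR
      · rw [map_mul, sq]; exact mul_le_mul' le_rfl hzR
    -- `|z(d u)| = |p|`
    have hd1 : w (d : (AlgebraicClosure (v.adicCompletion ℚ))) = 1 :=
      spectralValuation_natCast_eq_one_of_not_dvd hpv hw hdp
    have hzdu : w (d • uP).zCoord = w (p : (AlgebraicClosure (v.adicCompletion ℚ))) := by
      rw [val_zCoord_nsmul_eq_of_lt (w := w) d huPker (by rw [huPz, hd1]; exact hp1), hd1, one_mul,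
        huPz]
    have hcontra : w (p : (AlgebraicClosure (v.adicCompletion ℚ))) ≤
        w (p : (AlgebraicClosure (v.adicCompletion ℚ))) ^ 2 :=
      calc w (p : (AlgebraicClosure (v.adicCompletion ℚ))) = w (d • uP).zCoord := hzdu.symm
        _ = w (p • RP).zCoord := by rw [hpRP]
        _ ≤ w (p : (AlgebraicClosure (v.adicCompletion ℚ))) ^ 2 := hzpR
    have hlt : w (p : (AlgebraicClosure (v.adicCompletion ℚ))) ^ 2 <
        w (p : (AlgebraicClosure (v.adicCompletion ℚ))) := by
      rw [sq]; exact mul_lt_of_lt_one_left hp0 hp1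
    exact absurd hcontra (not_le.mpr hlt)
  have hinj : Set.InjOn (fun i ↦ oneCocycleClass X (φ i)) ↑(Finset.range p) := by
    intro i hi j hj hij
    rw [Finset.coe_range, Set.mem_Iio] at hi hj
    rcases lt_trichotomy i j with h | h | h
    · exact (hkey i j hj h hij.symm).elim
    · exact h
    · exact (hkey j i hi h hij).elim
  -- so the `p` Kummer classes exhaust `H¹(Γ, C)`
  haveI : Fintype (continuousCohomology 1 X) := Fintype.ofFinite _
  have huniv : (Finset.range p).image (fun i ↦ oneCocycleClass X (φ i)) = Finset.univ := by
    apply Finset.eq_univ_of_card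
    rw [Finset.card_image_of_injOn hinj, Finset.card_range, ← Nat.card_eq_fintype_card, hcardH]
  -- the given cocycle `f`
  obtain ⟨ψ, hψ⟩ := mkCocycle f hfc hf1 (fun σ ↦ (hmemC _).mpr ⟨(hker _).mpr (hfk σ), hfp σ⟩)
  obtain ⟨i, -, hi⟩ := Finset.mem_image.mp (huniv ▸ Finset.mem_univ (oneCocycleClass X ψ))
  obtain ⟨c, hc⟩ := hsub_class ψ (φ i) hi.symm
  refine ⟨Q i + (c : localPoints A (v.adicCompletion ℚ)), fun σ ↦ ?_⟩
  have h1 := hc σ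
  rw [hψ σ, hφ i σ] at h1
  rw [smul_add]
  have h2 : f σ = (σ • Q i - Q i) +
      (σ • (c : localPoints A (v.adicCompletion ℚ)) - (c : localPoints A (v.adicCompletion ℚ))) := by
    rw [← h1]; abel
  rw [h2]; abel

end Summit.BirchSwinnertonDyer.Rank1Residual.X11a.OrdinaryLine

end
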